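import Summits.BirchSwinnertonDyer.Rank1Residual.P2.ShuZhaiTwoFiftySixSlices
import Literature.NumberTheory.Sieve.PolymathLcmSumsEuler
import HarnessLib

/-!
# Cell `bsd-print-cf2` (D-0131 (2) PRINT TIER, leaf CornerF @ `p = 2`), seat p2 — the Shu–Zhai twists of `256c1`
# ON THE NOSE: the equation `y² = x³ + 2p²M²x` is a GLOBAL MINIMAL MODEL, so `ord_{s=1} L = 1 ∧ BSD(·, 2)` holds for
# the twist `curve256c1.quadraticTwist (−pM)` ITSELF (no model quantifier) — certificate currency for ty3

HONEST FRAMING (cell `bsd-print-cf2`, run/shared/lean/pub/bsd-print-cf2/). Companion of `P2/ShuZhaiTwoFiftySixSlices.lean`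
(p554475; HONEST FRAMING there): nothing class-wide is closed, no definition, no named fact. The slices state
`ord_{s=1} L(W,s) = 1 ∧ BSD(W,2)` for every globally minimal `ℚ`-MODEL `W` of `256c1^{(−pM)}`; the tree's `BSDp W 2` reads
`#Ш_an`, `Ω`, `c_ℓ` on a globally minimal model. Here the kernel shows that the twist equation ITSELF,
`curve256c1.quadraticTwist (−pM) = (y² = x³ + 2p²M²x)` (ty2's `quadraticTwist_curve256c1`), is globally minimal when
`pM` is square-free and odd (`Δ = −2⁹(pM)⁶`: `ord₂ Δ = 9 < 12`, `ord_q Δ ≤ 6` at odd `q`; Silverman VII.1 Rem 1.1, tree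
`isGloballyMinimal_of_int_criterion`), hence the by-name conclusion holds for that equation verbatim
(`analyticRank_eq_one_and_bsdp_two_quadraticTwist_curve256c1`): the shape a certificate record (ty3's
`CornerFTwoCertificates` schema: invariants read on the displayed model) consumes. Binders displayed, nothing else:
`h12`, `h14` (Shu–Zhai Thm 1.2 / 1.4), `hCM` (row C8), `hmod`, `hARS` (ARS06 Thm 2.6), `hbase`
(`ShuZhai2021.base256c1_optimal_cuspZero`). beyond-print theorem: NO.

References: [ShuZhai2021] Thm 1.2, Thm 1.4; [SilvermanAEC2009] VII.1 Remark 1.1, X.5 Cor 5.4; [Cremona1997] Table 1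
(256C1), Table 4 (256C); [AgasheRibetStein2006] Thm 2.6; [BurungaleFlach2024] Cor 2; [Miller2011LMS] Def 1.1.
-/

noncomputable section

open scoped Classical

open WeierstrassCurve NumberField Literature.NumberTheory.EllipticCurves
  Literature.NumberTheory.EllipticCurves.Rank1Residual
  Literature.NumberTheory.EllipticCurves.ModularForms
  Literature.NumberTheory.EllipticCurves.ShuZhai2021
  Literature.NumberTheory.EllipticCurves.Rank1Residual.X11RankOneCertificates
  Summit.BirchSwinnertonDyer.Rank1Residual

set_option autoImplicit false

namespace Summit.BirchSwinnertonDyer.Rank1Residual.P2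

/-! ## §1 The equation `y² = x³ + 2n²x` is globally minimal for `n` square-free and odd -/

/-- `Δ` of the integral quartic `[0, 0, 0, A, 0]` in the certificate schema: `−64A³`. [cite: SilvermanAEC2009, III.1 (Δ = −16(4A³ + 27B²))] -/
theorem discOf_quartic (A : ℤ) : discOf [0, 0, 0, A, 0] = -(64 * A ^ 3) := by
  simp [discOf, invariants]
  ring

/- A finite product of distinct primes is square-free: the tree's
`Literature.NumberTheory.Sieve.LcmEuler.squarefree_prod_of_primes` (not restated). -/

/-- **`p · ∏_{q ∈ Q} q` is square-free and odd** for a prime `p ≡ 7 (mod 8)` and a finite set `Q` of primes `≡ 5 (mod 8)`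
(the square-free twisting parameter `pM` of a Shu–Zhai member). [folklore] -/
theorem squarefree_and_odd_mul_prod {p : ℕ} (hp : p.Prime) (h8 : p % 8 = 7) {Q : Finset ℕ}
    (hQ : ∀ q ∈ Q, q.Prime ∧ q % 8 = 5) : Squarefree (p * ∏ q ∈ Q, q) ∧ ¬ 2 ∣ p * ∏ q ∈ Q, q := by
  constructor
  · refine Nat.squarefree_mul_iff.mpr ⟨?_, hp.squarefree, Literature.NumberTheory.Sieve.LcmEuler.squarefree_prod_of_primes fun q hq => (hQ q hq).1⟩
    refine Nat.Coprime.prod_right fun q hq => (Nat.coprime_primes hp (hQ q hq).1).mpr ?_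
    rintro rfl
    have := (hQ p hq).2
    omega
  · intro h2
    rcases (Nat.Prime.dvd_mul Nat.prime_two).mp h2 with h | h
    · have := (Nat.prime_dvd_prime_iff_eq Nat.prime_two hp).mp h; omega
    · obtain ⟨q, hq, hq2⟩ := (Prime.dvd_finsetProd_iff Nat.prime_two.prime _).mp h
      have := (Nat.prime_dvd_prime_iff_eq Nat.prime_two (hQ q hq).1).mp hq2
      have := (hQ q hq).2
      omega

/-- **The integral equation `y² = x³ + 2n²x` is a GLOBAL MINIMAL MODEL for `n` square-free and odd**: `Δ = −2⁹·n⁶` has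
`ord₂ Δ = 9 < 12` and `ord_q Δ = 6·ord_q n ≤ 6 < 12` at every odd prime `q` (Silverman's criterion `ord_q Δ < 12`, tree
`isGloballyMinimal_of_int_criterion`). [cite: SilvermanAEC2009, VII.1 Remark 1.1] -/
theorem isGloballyMinimal_quartic_two_mul_sq {n : ℕ} (hn : Squarefree n) (hodd : ¬ 2 ∣ n) :
    (⟨((0 : ℤ) : ℚ), ((0 : ℤ) : ℚ), ((0 : ℤ) : ℚ), ((2 * (n : ℤ) ^ 2 : ℤ) : ℚ), ((0 : ℤ) : ℚ)⟩ :
      WeierstrassCurve ℚ).IsGloballyMinimal := by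
  refine isGloballyMinimal_of_int_criterion 0 0 0 (2 * (n : ℤ) ^ 2) 0 fun q hq hboth => ?_
  have hΔ : discOf [0, 0, 0, 2 * (n : ℤ) ^ 2, 0] = -((512 * n ^ 6 : ℕ) : ℤ) := by
    rw [discOf_quartic]; push_cast; ring
  obtain ⟨h12, -⟩ := hboth
  rw [hΔ, Int.dvd_neg] at h12
  have h12' : q ^ 12 ∣ 512 * n ^ 6 := by exact_mod_cast h12
  rcases eq_or_ne q 2 with rfl | hq2
  · -- `2¹² ∣ 2⁹ · n⁶` with `n` odd is absurd
    have hcop : Nat.Coprime (2 ^ 12) (n ^ 6) :=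
      Nat.Coprime.pow 12 6 ((Nat.Prime.coprime_iff_not_dvd Nat.prime_two).2 hodd)
    have h := hcop.dvd_of_dvd_mul_right h12'
    norm_num at h
  · -- `q¹² ∣ n⁶` forces `q² ∣ n`, contradicting square-freeness
    have hcop : Nat.Coprime (q ^ 12) 512 := by
      have h : Nat.Coprime q 2 := (Nat.coprime_primes hq Nat.prime_two).2 hq2
      simpa using h.pow 12 9
    have h6 : q ^ 12 ∣ n ^ 6 := hcop.dvd_of_dvd_mul_left h12'
    have hq2n : q ^ 2 ∣ n := by
      rw [show q ^ 12 = (q ^ 2) ^ 6 by ring] at h6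
      exact (Nat.pow_dvd_pow_iff (by norm_num)).1 h6
    have hunit : IsUnit q := hn q (by simpa [sq] using hq2n)
    exact hq.ne_one (Nat.isUnit_iff.1 hunit)

/-- **The Shu–Zhai twist equation `256c1^{(−n)} = (y² = x³ + 2n²x)` is globally minimal** for `n` square-free and odd
(`curve256c1.quadraticTwist (−n)` on the nose, ty2's `quadraticTwist_curve256c1`). [cite: SilvermanAEC2009, VII.1 Remark 1.1 and X.5 Cor. 5.4] -/
theorem isGloballyMinimal_quadraticTwist_curve256c1 {n : ℕ} (hn : Squarefree n) (hodd : ¬ 2 ∣ n) :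
    (curve256c1.quadraticTwist (-(n : ℚ))).IsGloballyMinimal := by
  rw [quadraticTwist_curve256c1]
  convert isGloballyMinimal_quartic_two_mul_sq hn hodd using 2 <;> push_cast <;> ring

/-! ## §2 `ord_{s=1} L = 1 ∧ BSD(·, 2)` for the twist equation itself -/

/-- **`ord_{s=1} L = 1 ∧ BSD(·,2)` FOR THE EQUATION `y² = x³ + 2p²M²x` ITSELF** (`= curve256c1.quadraticTwist (−pM)`,
`p ≡ 7 (mod 8)` prime, `Q ⊂ {primes ≡ 5 (mod 8)}` of even cardinality, `M = ∏ q`): the equation is its own global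
minimal model (§1), so the by-name slice `analyticRank_eq_one_and_bsdp_two_of_twist_curve256c1_explicit` applies with
`C = 1`. Binders: `h12 h14 hCM hmod hARS hbase`. [cite: ShuZhai2021, Thm. 1.2 and Thm. 1.4]
[cite: Cremona1997, Table 1 (256C1) and Table 4 (256C)] [cite: AgasheRibetStein2006, Thm. 2.6]
[cite: BurungaleFlach2024, Cor. 2] [cite: Miller2011LMS, Def. 1.1] -/
theorem analyticRank_eq_one_and_bsdp_two_quadraticTwist_curve256c1 (h12 : thm12_ranks_of_twists)
    (h14 : thm14_twoPartBSD_of_twists) (hCM : bsdTriple_of_hasCM_of_L_one_ne_zero)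
    (hmod : hasEntireLFunction_rat)
    (hARS : AgasheRibetStein2006.cremona_abs_maninConstant_eq_one_of_level_le)
    (hbase : base256c1_optimal_cuspZero) {p : ℕ} (hp : p.Prime) (h8 : p % 8 = 7)
    {Q : Finset ℕ} (hQ : ∀ q ∈ Q, q.Prime ∧ q % 8 = 5) (heven : Q.card % 2 = 0) :
    (haveI := curve256c1.isElliptic_quadraticTwist
      (neg_ne_zero.mpr (Nat.cast_ne_zero.mpr (mul_prod_ne_zero_of_prime hp hQ)) : (-((p * ∏ q ∈ Q, q : ℕ) : ℚ)) ≠ 0);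
    haveI := isGloballyMinimal_quadraticTwist_curve256c1 (squarefree_and_odd_mul_prod hp h8 hQ).1
      (squarefree_and_odd_mul_prod hp h8 hQ).2;
    (curve256c1.quadraticTwist (-((p * ∏ q ∈ Q, q : ℕ) : ℚ))).analyticRank = 1 ∧
      BSDp (curve256c1.quadraticTwist (-((p * ∏ q ∈ Q, q : ℕ) : ℚ))) 2) := by
  haveI := curve256c1.isElliptic_quadraticTwist
    (neg_ne_zero.mpr (Nat.cast_ne_zero.mpr (mul_prod_ne_zero_of_prime hp hQ)) : (-((p * ∏ q ∈ Q, q : ℕ) : ℚ)) ≠ 0)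
  haveI := isGloballyMinimal_quadraticTwist_curve256c1 (squarefree_and_odd_mul_prod hp h8 hQ).1
    (squarefree_and_odd_mul_prod hp h8 hQ).2
  obtain ⟨_, Dt, hopt, hcusp⟩ := hbase
  exact analyticRank_eq_one_and_bsdp_two_of_twist_curve256c1_explicit h12 h14 hCM hmod Dt hopt hcusp
    (not_two_dvd_c_of_isOptimalDatum_curve256c1 hARS Dt hopt) hp h8 hQ heven _ ⟨1, one_smul _ _⟩

/-- **The `r = 0` equation `y² = x³ + 2p²x`** (`p ≡ 7 (mod 8)` prime): `ord_{s=1} L = 1 ∧ BSD(·,2)` for the equation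
`curve256c1.quadraticTwist (−p)` itself. Smallest member `p = 7`: `y² = x³ + 98x` (`N = 12544`).
[cite: ShuZhai2021, Thm. 1.2 and Thm. 1.4 (r = 0)] [cite: Cremona1997, Table 1 (256C1) and Table 4 (256C)] -/
theorem analyticRank_eq_one_and_bsdp_two_quadraticTwist_curve256c1_prime (h12 : thm12_ranks_of_twists)
    (h14 : thm14_twoPartBSD_of_twists) (hCM : bsdTriple_of_hasCM_of_L_one_ne_zero)
    (hmod : hasEntireLFunction_rat)
    (hARS : AgasheRibetStein2006.cremona_abs_maninConstant_eq_one_of_level_le)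
    (hbase : base256c1_optimal_cuspZero) {p : ℕ} (hp : p.Prime) (h8 : p % 8 = 7) :
    (haveI := curve256c1.isElliptic_quadraticTwist
      (neg_ne_zero.mpr (Nat.cast_ne_zero.mpr hp.ne_zero) : (-(p : ℚ)) ≠ 0);
    haveI := isGloballyMinimal_quadraticTwist_curve256c1 hp.squarefree
      (fun h => by have := (Nat.prime_dvd_prime_iff_eq Nat.prime_two hp).mp h; omega);
    (curve256c1.quadraticTwist (-(p : ℚ))).analyticRank = 1 ∧ BSDp (curve256c1.quadraticTwist (-(p : ℚ))) 2) := by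
  haveI := curve256c1.isElliptic_quadraticTwist (neg_ne_zero.mpr (Nat.cast_ne_zero.mpr hp.ne_zero) : (-(p : ℚ)) ≠ 0)
  haveI := isGloballyMinimal_quadraticTwist_curve256c1 hp.squarefree
    (fun h => by have := (Nat.prime_dvd_prime_iff_eq Nat.prime_two hp).mp h; omega)
  obtain ⟨_, Dt, hopt, hcusp⟩ := hbase
  exact analyticRank_eq_one_and_bsdp_two_of_twist_curve256c1_prime h12 h14 hCM hmod Dt hopt hcusp
    (not_two_dvd_c_of_isOptimalDatum_curve256c1 hARS Dt hopt) hp h8 _ ⟨1, one_smul _ _⟩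

end Summit.BirchSwinnertonDyer.Rank1Residual.P2

end
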